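import Literature.Algebra.Polynomial.PadicRootMultiplicityRigidity
import Literature.NumberTheory.EllipticCurves.TateModuleKernelIndexProofs
import Literature.NumberTheory.EllipticCurves.TateModuleCharpolyOfDegree
import Literature.NumberTheory.LFunctions.FrobeniusCharpolyOfDet
import HarnessLib

/-!
# Integrality and `ℓ`-independence of `charpoly (T_ℓ φ)` from a polynomial kernel bound

Sibling proof file (theorems only; no definitions, no named facts) of `TateModuleKernelIndexProofs`
and `TateModuleCharpolyOfDegree`, in the generic setting of those files: an abelian group `A`, primes `p`
(and `q`) with `#A[p^n] = p^{dn}` for all `n` (so `T_p A ≅ ℤ_p^d`), and an endomorphism `φ` of `A`.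

Write `S_p(F) = {a ∈ A[p^∞] | F(φ) a = 0}` for `F ∈ ℤ[X]`, and let `m_j ∈ ℤ[X]` (`j ∈ J`, finite) be
monic, irreducible and pairwise distinct (`IsGoodFamily m`, `Literature.Algebra.Polynomial.RootRigidity`)
such that an integer polynomial `m₀` all of whose roots are roots of the `m_j` kills `φ`.  Suppose a
KERNEL BOUND: a function `N : ℤ[X] → ℝ` with `#S_p(F) ≤ N(F)` for every `F` divisible by no `m_j`, and,
for every degree budget `r`, `N(F) ≤ C(r) · H(F)^d` for such `F` of degree `< r` (`H` = naive height).

* `TateModule.kerNorm_charpoly_map_eq_natCard` — **`∏_{Q_p(b)=0} |F(b)|_p⁻¹ = #S_p(F)`** for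
  `Q_p = charpoly (T_p φ)` and finite `S_p(F)` (the kernel–cokernel count `|det T_p F(φ)|_p⁻¹ = #S_p(F)` of
  `TateModuleKernelIndexProofs` and the spectral mapping `det F(M) = ∏ F(bᵢ)` of `FrobeniusCharpolyOfDet`);
* `TateModule.eval_map_eq_zero_of_isRoot_charpoly` — a polynomial killing a matrix kills its eigenvalues;
* `TateModule.charpoly_map_eq_prod_pow_of_kernelBound` — **one prime**: `Q_p = ∏_j m_j^{n_j}` for some
  `n_j ≥ 0` with `∑ n_j deg m_j = d`; in particular `Q_p ∈ ℤ[X]`;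
* `TateModule.rootMultiplicity_charpoly_map_le_of_kernelBound`,
  `TateModule.charpoly_map_eq_prod_pow_of_kernelBound₂` — **two primes**: if moreover `#A[q^n] = q^{d'n}`
  and the JOINT bound `#S_p(F) · #S_q(F) ≤ N(F)` holds, then every root of `m_j` has multiplicity `≤ n_j` in
  `Q_q = charpoly (T_q φ)`, and `Q_q = ∏_j m_j^{n_j}` if `d' = d`.

These are the abstract rigidity theorems of `PadicRootMultiplicityRigidity` with their `kerNorm` hypothesis
translated into kernel counts.  For the Frobenius `π` of an abelian variety over a finite field (`A` its group
of `k̄`-points, `N(F) = deg F(π)`, the bound being the theorem of the cube) they yield Weil's theorem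
"`charpoly (π | T_ℓ A) ∈ ℤ[X]` is independent of `ℓ ≠ char`" (Mumford §19 Thm. 4 with §21; Milne 1986
Thm. 19.1 (a)) and the domination of the `p`-adic étale multiplicities — see
`Motives/AbelianVarietyFrobeniusCharpolyRigidity` — without Mumford §19 Thm. 2 (polynomiality of `deg`).

## References

* D. Mumford, *Abelian Varieties*, TIFR Studies in Mathematics 5 (1970): §19, Thm. 4; §21. [MumfordAV1970]
* J. S. Milne, *Abelian Varieties*, in Cornell–Silverman (eds.), *Arithmetic Geometry* (1986): §12,
  Prop. 12.9 (proof, p. 125); §19, Thm. 19.1 (a). [Milne1986AbelianVarieties]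

## Design

Pure theorems in `namespace Literature.NumberTheory.EllipticCurves.TateModule`; the route (kernel bound ⇒
rigidity) is this tree's own, the cited statements are what it proves downstream.  Mathlib used:
`Matrix.charpoly_map`, `Matrix.eval_charpoly`, `Matrix.det_neg`, `Polynomial.map_aeval_eq_aeval_map`,
`Polynomial.modByMonic_X_sub_C_eq_C_eval`, `LinearMap.charpoly_toMatrix`, `LinearMap.charpoly_natDegree`,
`RingHom.map_det`, `Polynomial.aeval_algHom_apply`.
-/

noncomputable section

open scoped Classical AddSubgroup
open Polynomial

universe u

namespace Literature.NumberTheory.EllipticCurves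

namespace TateModule

open Literature.Algebra.Polynomial.RootRigidity Literature.NumberTheory.LFunctions

/-! ### Eigenvalues are killed by annihilating polynomials -/

/-- **A polynomial killing a matrix kills its eigenvalues**: if `m₀(M) = 0` for a square matrix `M` over a
commutative ring `R` and `b` is a root of `charpoly M` in a field `K ⊇ R`, then `m₀(b) = 0`.  Proof:
`m₀ = (X - b) G + m₀(b)`, so `m₀(b) · 1 = -(M - b) G(M)` over `K` and taking determinants
`m₀(b)^n = ± charpoly_M(b) · det G(M) = 0`. [folklore] -/
theorem eval_map_eq_zero_of_isRoot_charpoly {R K : Type*} [CommRing R] [Field K] (f : R →+* K)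
    {n : Type*} [Fintype n] [DecidableEq n] (M : Matrix n n R) {m₀ : R[X]} (hm₀ : aeval M m₀ = 0)
    {b : K} (hb : (M.charpoly.map f).IsRoot b) : (m₀.map f).eval b = 0 := by
  set M' : Matrix n n K := M.map f with hM'
  set g : K[X] := m₀.map f with hg
  -- `g(M') = 0`
  have h1 : aeval M' g = 0 := by
    have h := Polynomial.map_aeval_eq_aeval_map (R := R) (S := Matrix n n R) (T := K)
      (U := Matrix n n K) (φ := f) (ψ := f.mapMatrix) (by
        ext r i j
        simp only [RingHom.coe_comp, Function.comp_apply, Matrix.algebraMap_matrix_apply,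
          RingHom.mapMatrix_apply, Matrix.map_apply]
        split_ifs <;> simp) m₀ M
    rw [hm₀, map_zero] at h
    rw [hg, hM']
    exact h.symm
  -- `charpoly M' (b) = 0`
  have hb' : M'.charpoly.eval b = 0 := by
    rw [hM', Matrix.charpoly_map, ← Polynomial.IsRoot.def]
    exact hb
  -- division by `X - b`
  have hdiv : g %ₘ (X - C b) + (X - C b) * (g /ₘ (X - C b)) = g := modByMonic_add_div g (X - C b)
  rw [modByMonic_X_sub_C_eq_C_eval] at hdiv
  have h2 : algebraMap K (Matrix n n K) (g.eval b) =
      -((M' - algebraMap K (Matrix n n K) b) * aeval M' (g /ₘ (X - C b))) := by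
    have h := congrArg (aeval M') hdiv
    rw [h1, map_add, map_mul, map_sub, aeval_X, aeval_C, aeval_C] at h
    exact eq_neg_of_add_eq_zero_left h
  have h3 := congrArg Matrix.det h2
  rw [Matrix.algebraMap_eq_diagonal, Pi.algebraMap_def, Algebra.algebraMap_self, RingHom.id_apply,
    Matrix.det_diagonal, Finset.prod_const, Finset.card_univ, Matrix.det_neg, Matrix.det_mul] at h3
  have h4 : (M' - algebraMap K (Matrix n n K) b).det = 0 := by
    have h5 : M' - algebraMap K (Matrix n n K) b = -(Matrix.scalar n b - M') := by
      rw [neg_sub, Matrix.scalar_apply, Matrix.algebraMap_eq_diagonal]; rfl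
    rw [h5, Matrix.det_neg, ← Matrix.eval_charpoly, hb', mul_zero]
  rw [h4, zero_mul, mul_zero] at h3
  by_cases hn : Fintype.card n = 0
  · -- no eigenvalues at all
    haveI : IsEmpty n := Fintype.card_eq_zero_iff.mp hn
    exfalso
    have h6 : M'.charpoly = 1 := by
      rw [Matrix.charpoly, Matrix.det_isEmpty]
    rw [h6, eval_one] at hb'
    exact one_ne_zero hb'
  · exact pow_eq_zero_iff hn |>.mp h3

variable {A : Type u} [AddCommGroup A] {p : ℕ} [Fact p.Prime] {d : ℕ}

/-- `T_p(0) = 0`. [folklore] -/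
theorem map_zero_eq : map p (0 : A →+ A) = 0 :=
  LinearMap.ext fun x => TateModule.ext fun n => by rw [proj_map]; rfl

/-- `F(T_p φ)` in a basis: `F(matrix of T_p φ) = matrix of T_p(F(φ))` for `F ∈ ℤ[X]`. [folklore] -/
theorem aeval_toMatrix_map {ι : Type*} [Fintype ι] [DecidableEq ι] (b : Module.Basis ι ℤ_[p] (TateModule A p))
    (φ : AddMonoid.End A) (F : ℤ[X]) :
    aeval (LinearMap.toMatrix b b (map p (φ : A →+ A))) F =
      LinearMap.toMatrix b b (map p ((aeval φ F : AddMonoid.End A) : A →+ A)) := by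
  rw [map_aeval]
  change aeval ((LinearMap.toMatrixAlgEquiv b).toAlgHom.toRingHom.toIntAlgHom (map p (φ : A →+ A))) F = _
  rw [Polynomial.aeval_algHom_apply]
  rfl

/-- The roots of `charpoly (T_p φ)` in `\overline{ℚ_p}` are killed by every integer polynomial killing `φ`.
[folklore] -/
theorem aeval_eq_zero_of_mem_roots_charpoly_map [Module.Free ℤ_[p] (TateModule A p)]
    [Module.Finite ℤ_[p] (TateModule A p)] (φ : AddMonoid.End A) {m₀ : ℤ[X]}
    (hm₀ : (aeval φ m₀ : AddMonoid.End A) = 0) {b : PadicAlgCl p}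
    (hb : b ∈ ((map p (φ : A →+ A)).charpoly.map (algebraMap ℤ_[p] (PadicAlgCl p))).roots) :
    aeval b m₀ = 0 := by
  set bs := Module.Free.chooseBasis ℤ_[p] (TateModule A p)
  set M := LinearMap.toMatrix bs bs (map p (φ : A →+ A)) with hM
  have hchar : (map p (φ : A →+ A)).charpoly = M.charpoly := (LinearMap.charpoly_toMatrix _ bs).symm
  have hkill : aeval M (m₀.map (Int.castRingHom ℤ_[p])) = 0 := by
    rw [show Int.castRingHom ℤ_[p] = algebraMap ℤ ℤ_[p] from (algebraMap_int_eq ℤ_[p]).symm,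
      Polynomial.aeval_map_algebraMap, hM, aeval_toMatrix_map, hm₀]
    change LinearMap.toMatrix bs bs (map p (0 : A →+ A)) = 0
    rw [map_zero_eq, map_zero]
  have hroot : (M.charpoly.map (algebraMap ℤ_[p] (PadicAlgCl p))).IsRoot b := by
    rw [← hchar]
    exact (mem_roots ((Polynomial.map_monic_ne_zero (LinearMap.charpoly_monic _)))).mp hb
  have h := eval_map_eq_zero_of_isRoot_charpoly (algebraMap ℤ_[p] (PadicAlgCl p)) M hkill hroot
  rw [aeval_eq_eval_map_map]
  exact h

/-! ### `kerNorm (charpoly T_p φ) F = #S_p(F)` -/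

/-- **`∏_{Q_p(b) = 0} |F(b)|_p⁻¹ = #{a ∈ A[p^∞] | F(φ) a = 0}`** for `Q_p = charpoly (T_p φ)`, when that set is
finite: the `p`-adic size of `det F(T_p φ) = ∏ F(bᵢ)` (spectral mapping over `\overline{ℚ_p}`) is the inverse
of the order of the `p`-primary kernel (`norm_det_map_eq_inv_natCard`).
[cite: Milne1986AbelianVarieties, §12, proof of Prop. 12.9, p. 125] -/
theorem kerNorm_charpoly_map_eq_natCard [Module.Free ℤ_[p] (TateModule A p)]
    [Module.Finite ℤ_[p] (TateModule A p)]
    (hcard : ∀ n, Nat.card (A[(p ^ n : ℕ)]) = p ^ (d * n)) (φ : AddMonoid.End A) (F : ℤ[X])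
    (hfin : {a : A | (∃ n : ℕ, p ^ n • a = 0) ∧ (aeval φ F : AddMonoid.End A) a = 0}.Finite) :
    kerNorm (map p (φ : A →+ A)).charpoly F =
      Nat.card {a : A | (∃ n : ℕ, p ^ n • a = 0) ∧ (aeval φ F : AddMonoid.End A) a = 0} := by
  set bs := Module.Free.chooseBasis ℤ_[p] (TateModule A p)
  set M := LinearMap.toMatrix bs bs (map p (φ : A →+ A)) with hM
  set f := algebraMap ℤ_[p] (PadicAlgCl p) with hf
  have hchar : (map p (φ : A →+ A)).charpoly = M.charpoly := (LinearMap.charpoly_toMatrix _ bs).symm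
  -- `|det T_p F(φ)|_p = (#S)⁻¹`
  have hdet := norm_det_map_eq_inv_natCard hcard ((aeval φ F : AddMonoid.End A) : A →+ A) hfin
  -- `det T_p F(φ) = det F(M)`
  have hdet2 : LinearMap.det (map p ((aeval φ F : AddMonoid.End A) : A →+ A)) = (aeval M F).det := by
    rw [hM, aeval_toMatrix_map, LinearMap.det_toMatrix]
  -- `det F(M) ↦ ∏ F(b)` in `\overline{ℚ_p}`
  have hmap : f (aeval M F).det = ((M.charpoly.map f).roots.map fun b => aeval b F).prod := by
    rw [RingHom.map_det, ← Matrix.charpoly_map]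
    have h1 : f.mapMatrix (aeval M F) = aeval (M.map f) (F.map (algebraMap ℤ (PadicAlgCl p))) := by
      have h := Polynomial.map_aeval_eq_aeval_map (R := ℤ) (S := Matrix _ _ ℤ_[p]) (T := PadicAlgCl p)
        (U := Matrix _ _ (PadicAlgCl p)) (φ := algebraMap ℤ (PadicAlgCl p)) (ψ := f.mapMatrix)
        (RingHom.ext_int _ _) F M
      rw [h]
      rfl
    rw [h1, FrobeniusCharpoly.det_aeval_eq_prod_roots]
    refine congrArg Multiset.prod (Multiset.map_congr rfl fun b _ => ?_)
    rw [eval_map_algebraMap]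
  -- norms
  have hnorm : ‖LinearMap.det (map p ((aeval φ F : AddMonoid.End A) : A →+ A))‖ =
      ((M.charpoly.map f).roots.map fun b => ‖aeval b F‖).prod := by
    rw [hdet2, ← PadicInt.padic_norm_e_of_padicInt, ← PadicAlgCl.norm_extends p,
      show ((↑(aeval M F).det : ℚ_[p]) : PadicAlgCl p) = f (aeval M F).det from rfl, hmap]
    exact map_multiset_prod (normHom : PadicAlgCl p →*₀ ℝ) _ |>.trans (by rw [Multiset.map_map]; rfl)
  rw [kerNorm, hchar, Multiset.prod_map_inv, ← hnorm, hdet, inv_inv]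
  rfl

/-! ### One prime -/

/-- **Rigidity at one prime: `charpoly (T_p φ) = ∏_j m_j^{n_j} ∈ ℤ[X]`.**  Let `#A[p^n] = p^{dn}` for all `n`,
`φ ∈ End A`, `m_j ∈ ℤ[X]` monic irreducible pairwise distinct, `m₀ ∈ ℤ[X]` with `m₀(φ) = 0` all of whose roots
in `\overline{ℚ_p}` are roots of the `m_j`, and `N : ℤ[X] → ℝ` with `#S_p(F) ≤ N(F)` (`S_p(F)` the finite set of
`p`-power-torsion elements killed by `F(φ)`) for all `F` divisible by no `m_j`, and `N(F) ≤ C(r) H(F)^d` for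
such `F` of degree `< r`.  Then `charpoly (T_p φ) = ∏_j m_j^{n_j}` with `∑_j n_j deg m_j = d`, and every root of
`m_j` has multiplicity exactly `n_j`. [folklore] -/
theorem charpoly_map_eq_prod_pow_of_kernelBound [Module.Free ℤ_[p] (TateModule A p)]
    [Module.Finite ℤ_[p] (TateModule A p)]
    (hcard : ∀ n, Nat.card (A[(p ^ n : ℕ)]) = p ^ (d * n)) (φ : AddMonoid.End A)
    {J : Type*} [Fintype J] {m : J → ℤ[X]} (hm : IsGoodFamily m)
    {m₀ : ℤ[X]} (hm₀ : (aeval φ m₀ : AddMonoid.End A) = 0)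
    (hm₀J : ∀ b : PadicAlgCl p, aeval b m₀ = 0 → ∃ j, aeval b (m j) = 0)
    (N : ℤ[X] → ℝ)
    (hK : ∀ F : ℤ[X], (∀ j, ¬ m j ∣ F) →
      {a : A | (∃ n : ℕ, p ^ n • a = 0) ∧ (aeval φ F : AddMonoid.End A) a = 0}.Finite ∧
        (Nat.card {a : A | (∃ n : ℕ, p ^ n • a = 0) ∧ (aeval φ F : AddMonoid.End A) a = 0} : ℝ) ≤ N F)
    (hB : ∀ r : ℕ, ∃ C : ℝ, ∀ F : ℤ[X], F.natDegree < r → (∀ j, ¬ m j ∣ F) →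
      N F ≤ C * (height F : ℝ) ^ d) :
    ∃ n : J → ℕ, (map p (φ : A →+ A)).charpoly = ∏ j, ((m j).map (algebraMap ℤ ℤ_[p])) ^ n j ∧
      (∑ j, n j * (m j).natDegree = d) ∧
      ∀ j, ∀ θ ∈ rts p m j,
        rootMultiplicity θ ((map p (φ : A →+ A)).charpoly.map (algebraMap ℤ_[p] (PadicAlgCl p))) = n j := by
  set Q := (map p (φ : A →+ A)).charpoly with hQ
  have hQm : Q.Monic := LinearMap.charpoly_monic _
  have hQd : Q.natDegree = d := by
    rw [hQ, LinearMap.charpoly_natDegree, finrank_eq_of_card_torsionBy hcard]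
  have hroots : ∀ b ∈ (Q.map (algebraMap ℤ_[p] (PadicAlgCl p))).roots, ∃ j, b ∈ rts p m j := by
    intro b hb
    obtain ⟨j, hj⟩ := hm₀J b (aeval_eq_zero_of_mem_roots_charpoly_map φ hm₀ hb)
    exact ⟨j, (hm.mem_rts_iff).2 hj⟩
  have hbound : ∀ r : ℕ, ∃ C : ℝ, ∀ F : ℤ[X], F.natDegree < r → (∀ j, ¬ m j ∣ F) →
      kerNorm Q F ≤ C * (height F : ℝ) ^ Q.natDegree := by
    intro r
    obtain ⟨C, hC⟩ := hB r
    refine ⟨C, fun F hF hFm => ?_⟩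
    obtain ⟨hfin, hle⟩ := hK F hFm
    rw [hQ, kerNorm_charpoly_map_eq_natCard hcard φ F hfin, ← hQ, hQd]
    exact hle.trans (hC F hF hFm)
  obtain ⟨n, hQeq, hsum, hmult⟩ := hm.eq_prod_pow_of_kerNorm_le hQm hroots hbound
  exact ⟨n, hQeq, hQd ▸ hsum, hmult⟩

/-! ### Two primes -/

variable {q : ℕ} [Fact q.Prime] {d' : ℕ}

/-- **Rigidity across two primes (domination).**  In the situation of
`charpoly_map_eq_prod_pow_of_kernelBound` at `p` (giving `charpoly (T_p φ) = ∏ m_j^{n_j}`,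
`∑ n_j deg m_j = d`), let also `#A[q^n] = q^{d' n}` and suppose the JOINT kernel bound
`#S_p(F) · #S_q(F) ≤ N(F)` for `F` divisible by no `m_j`.  Then every root of `m_j` in `\overline{ℚ_q}` has
multiplicity `≤ n_j` in `charpoly (T_q φ)`. [folklore] -/
theorem rootMultiplicity_charpoly_map_le_of_kernelBound
    [Module.Free ℤ_[p] (TateModule A p)] [Module.Finite ℤ_[p] (TateModule A p)]
    [Module.Free ℤ_[q] (TateModule A q)] [Module.Finite ℤ_[q] (TateModule A q)]
    (hcard : ∀ n, Nat.card (A[(p ^ n : ℕ)]) = p ^ (d * n))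
    (hcard' : ∀ n, Nat.card (A[(q ^ n : ℕ)]) = q ^ (d' * n)) (φ : AddMonoid.End A)
    {J : Type*} [Fintype J] {m : J → ℤ[X]} (hm : IsGoodFamily m)
    {m₀ : ℤ[X]} (hm₀ : (aeval φ m₀ : AddMonoid.End A) = 0)
    (hm₀J : ∀ b : PadicAlgCl q, aeval b m₀ = 0 → ∃ j, aeval b (m j) = 0)
    {n : J → ℕ} (hn : (map p (φ : A →+ A)).charpoly = ∏ j, ((m j).map (algebraMap ℤ ℤ_[p])) ^ n j)
    (hsum : ∑ j, n j * (m j).natDegree = d)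
    (N : ℤ[X] → ℝ)
    (hK : ∀ F : ℤ[X], (∀ j, ¬ m j ∣ F) →
      {a : A | (∃ n : ℕ, p ^ n • a = 0) ∧ (aeval φ F : AddMonoid.End A) a = 0}.Finite ∧
      {a : A | (∃ n : ℕ, q ^ n • a = 0) ∧ (aeval φ F : AddMonoid.End A) a = 0}.Finite ∧
        (Nat.card {a : A | (∃ n : ℕ, p ^ n • a = 0) ∧ (aeval φ F : AddMonoid.End A) a = 0} : ℝ) *
          Nat.card {a : A | (∃ n : ℕ, q ^ n • a = 0) ∧ (aeval φ F : AddMonoid.End A) a = 0} ≤ N F)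
    (hB : ∀ r : ℕ, ∃ C : ℝ, ∀ F : ℤ[X], F.natDegree < r → (∀ j, ¬ m j ∣ F) →
      N F ≤ C * (height F : ℝ) ^ d)
    (j₀ : J) {θ₀ : PadicAlgCl q} (hθ₀ : θ₀ ∈ rts q m j₀) :
    rootMultiplicity θ₀ ((map q (φ : A →+ A)).charpoly.map (algebraMap ℤ_[q] (PadicAlgCl q))) ≤ n j₀ := by
  set Q' := (map q (φ : A →+ A)).charpoly with hQ'
  have hQ'm : Q'.Monic := LinearMap.charpoly_monic _
  have hroots' : ∀ b ∈ (Q'.map (algebraMap ℤ_[q] (PadicAlgCl q))).roots, ∃ j, b ∈ rts q m j := by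
    intro b hb
    obtain ⟨j, hj⟩ := hm₀J b (aeval_eq_zero_of_mem_roots_charpoly_map φ hm₀ hb)
    exact ⟨j, (hm.mem_rts_iff).2 hj⟩
  have hbound : ∀ r : ℕ, ∃ C : ℝ, ∀ F : ℤ[X], F.natDegree < r → (∀ j, ¬ m j ∣ F) →
      kerNorm (∏ j, ((m j).map (algebraMap ℤ ℤ_[p])) ^ n j) F * kerNorm Q' F ≤ C * (height F : ℝ) ^ d := by
    intro r
    obtain ⟨C, hC⟩ := hB r
    refine ⟨C, fun F hF hFm => ?_⟩
    obtain ⟨hfinp, hfinq, hle⟩ := hK F hFm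
    rw [← hn, kerNorm_charpoly_map_eq_natCard hcard φ F hfinp, hQ',
      kerNorm_charpoly_map_eq_natCard hcard' φ F hfinq]
    exact hle.trans (hC F hF hFm)
  exact hm.rootMultiplicity_le_of_kerNorm_mul_le (p := p) n hsum hQ'm hroots' hbound j₀ hθ₀

/-- **Rigidity across two primes (`ℓ`-independence).**  In the situation of
`rootMultiplicity_charpoly_map_le_of_kernelBound`, if the two Tate modules have the same rank (`d' = d`), then
`charpoly (T_q φ) = ∏_j m_j^{n_j}` as well: the characteristic polynomials of `T_p φ` and `T_q φ` are the same
integer polynomial. [folklore] -/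
theorem charpoly_map_eq_prod_pow_of_kernelBound₂
    [Module.Free ℤ_[p] (TateModule A p)] [Module.Finite ℤ_[p] (TateModule A p)]
    [Module.Free ℤ_[q] (TateModule A q)] [Module.Finite ℤ_[q] (TateModule A q)]
    (hcard : ∀ n, Nat.card (A[(p ^ n : ℕ)]) = p ^ (d * n))
    (hcard' : ∀ n, Nat.card (A[(q ^ n : ℕ)]) = q ^ (d * n)) (φ : AddMonoid.End A)
    {J : Type*} [Fintype J] {m : J → ℤ[X]} (hm : IsGoodFamily m)
    {m₀ : ℤ[X]} (hm₀ : (aeval φ m₀ : AddMonoid.End A) = 0)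
    (hm₀J : ∀ b : PadicAlgCl q, aeval b m₀ = 0 → ∃ j, aeval b (m j) = 0)
    {n : J → ℕ} (hn : (map p (φ : A →+ A)).charpoly = ∏ j, ((m j).map (algebraMap ℤ ℤ_[p])) ^ n j)
    (hsum : ∑ j, n j * (m j).natDegree = d)
    (N : ℤ[X] → ℝ)
    (hK : ∀ F : ℤ[X], (∀ j, ¬ m j ∣ F) →
      {a : A | (∃ n : ℕ, p ^ n • a = 0) ∧ (aeval φ F : AddMonoid.End A) a = 0}.Finite ∧
      {a : A | (∃ n : ℕ, q ^ n • a = 0) ∧ (aeval φ F : AddMonoid.End A) a = 0}.Finite ∧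
        (Nat.card {a : A | (∃ n : ℕ, p ^ n • a = 0) ∧ (aeval φ F : AddMonoid.End A) a = 0} : ℝ) *
          Nat.card {a : A | (∃ n : ℕ, q ^ n • a = 0) ∧ (aeval φ F : AddMonoid.End A) a = 0} ≤ N F)
    (hB : ∀ r : ℕ, ∃ C : ℝ, ∀ F : ℤ[X], F.natDegree < r → (∀ j, ¬ m j ∣ F) →
      N F ≤ C * (height F : ℝ) ^ d) :
    (map q (φ : A →+ A)).charpoly = ∏ j, ((m j).map (algebraMap ℤ ℤ_[q])) ^ n j := by
  set Q' := (map q (φ : A →+ A)).charpoly with hQ'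
  have hQ'm : Q'.Monic := LinearMap.charpoly_monic _
  have hQ'd : Q'.natDegree = d := by
    rw [hQ', LinearMap.charpoly_natDegree, finrank_eq_of_card_torsionBy hcard']
  have hroots' : ∀ b ∈ (Q'.map (algebraMap ℤ_[q] (PadicAlgCl q))).roots, ∃ j, b ∈ rts q m j := by
    intro b hb
    obtain ⟨j, hj⟩ := hm₀J b (aeval_eq_zero_of_mem_roots_charpoly_map φ hm₀ hb)
    exact ⟨j, (hm.mem_rts_iff).2 hj⟩
  have hbound : ∀ r : ℕ, ∃ C : ℝ, ∀ F : ℤ[X], F.natDegree < r → (∀ j, ¬ m j ∣ F) →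
      kerNorm (∏ j, ((m j).map (algebraMap ℤ ℤ_[p])) ^ n j) F * kerNorm Q' F ≤
        C * (height F : ℝ) ^ Q'.natDegree := by
    intro r
    obtain ⟨C, hC⟩ := hB r
    refine ⟨C, fun F hF hFm => ?_⟩
    obtain ⟨hfinp, hfinq, hle⟩ := hK F hFm
    rw [← hn, kerNorm_charpoly_map_eq_natCard hcard φ F hfinp, hQ',
      kerNorm_charpoly_map_eq_natCard hcard' φ F hfinq, ← hQ', hQ'd]
    exact hle.trans (hC F hF hFm)
  exact hm.eq_prod_pow_of_kerNorm_mul_le (p := p) n hQ'm (hsum.trans hQ'd.symm) hroots' hbound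

end TateModule

end Literature.NumberTheory.EllipticCurves

end
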